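import Summits.RiemannHypothesis.RiemannHypothesis.Theorems.WeilFormatCWindowParseval
import Summits.RiemannHypothesis.RiemannHypothesis.Theorems.WeilFormatCDeflatedFarSectorEven
import Summits.RiemannHypothesis.RiemannHypothesis.Theorems.WeilFormatCDeflatedFarSectorOdd
import Summits.RiemannHypothesis.RiemannHypothesis.Theorems.WeilFormatCDeflatedFarIdentify
import HarnessLib

/-!
# Format C, design C∞: the profile far-Gram series `E∞` of the front door in CLOSED FORM (Parseval)

Route context: Fourier–Galerkin / Schur-complement certificates of Weil positivity on a window ("format C";
cell memo `run/shared/lean/pub/rh-explicit/rh-explicit-weil-2/gen9/CINF-DOOR-SIZING.md`; supporting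
stmt-RiemannHypothesis-0098; seat rh-explicit-weil-2, (E) side of the C∞ door of rh-explicit-weil-10).

The C∞ front door `weilPositivityOn_of_formatC_cinf` carries, in its kernel inequality `hS`, the series
`E∞(j,j') = Σ_{n ≥ B'+1} V_j(n)V_{j'}(n)` of the even-sector far tables `V_j(n) = d_n² Re ĉ_n(1f_j)/√(2a)` (`d_0² = 1`,
`d_n² = 2`).  For the (E) side this series need not be enclosed by partial sums and tails: by Parseval on the window
(`hasSum_fourierCoeff_mul_conj`) it is the CLOSED FORM

  `E∞ = 2·Re ∫ 1f · conj(1g) − 2·V_f(0)V_g(0) − Σ_{1 ≤ n ≤ B'} V_f(n)V_g(n)`,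

i.e. a window integral of the two profiles (a rational number for polynomial profiles and rational `a`) minus finitely
many block coefficients.

* `hasSum_re_fourierCoeff_mul_of_even_real` / `hasSum_im_fourierCoeff_mul_of_odd_real` — Parseval folded to `ℕ`
  for even (resp. odd) real windows of the summable class;
* `tsum_table_eq_of_hasSum` / `tsum_shiftTable_eq_of_hasSum` — the series bookkeeping (pure real analysis);
* `tsum_evenTable_mul_eq` — the door's even `E∞` expression, verbatim, in closed form for `C³` even real profiles with
  `f′(−a) = f′(a)`;
* `tsum_oddTable_mul_eq` — the odd `E∞` (`V_f(k) = 2 Im ĉ_{k+1}(1f)/√(2a)`): `2 Re ∫ 1f conj(1g) − Σ_{k<B} V_f(k)V_g(k)`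
  for `C³` odd real profiles with `f(a) = 0`, `f′(−a) = f′(a)`.

Standard axioms; no definitions; no RH claim.
-/

set_option autoImplicit false
-- `Summit.RiemannHypothesis.RiemannHypothesis.…` is the layout-mandated namespace (summit = problem name).
set_option linter.dupNamespace false

noncomputable section

open Complex Filter Set MeasureTheory Finset
open scoped Real Topology ComplexConjugate

namespace Summit.RiemannHypothesis.RiemannHypothesis.Theorems.WeilFormatC

open Literature.NumberTheory.LFunctions Literature.NumberTheory.LFunctions.Yoshida1992

variable {a : ℝ}

/-! ## Parseval folded to `ℕ` for even real windows -/

/-- For even real windows `φ, ψ` of the summable class (`a > 0`): with `t_n = Re ĉ_n(φ)·Re ĉ_n(ψ)/(2a)`,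
`HasSum (n : ℕ ↦ t_n + t_n) (Re ∫ φ conj ψ + t_0)` — Parseval over `ℤ` folded by `ĉ_{−n} = ĉ_n ∈ ℝ`. -/
theorem hasSum_re_fourierCoeff_mul_of_even_real (ha : 0 < a) {φ ψ : ℝ → ℂ}
    (hzφ : ∀ x, x ∉ Icc (-a) a → φ x = 0) (hcφ : ContinuousOn φ (Icc (-a) a)) (heφ : ∀ x, φ (-x) = φ x)
    (hrφ : ∀ x, conj (φ x) = φ x) (hsφ : Summable fun n : ℤ ↦ ‖Yoshida1992.fourierCoeff a n φ‖)
    (hcψ : ContinuousOn ψ (Icc (-a) a)) (heψ : ∀ x, ψ (-x) = ψ x) (hrψ : ∀ x, conj (ψ x) = ψ x)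
    (hsψ : Summable fun n : ℤ ↦ ‖Yoshida1992.fourierCoeff a n ψ‖) :
    HasSum (fun n : ℕ ↦ (Yoshida1992.fourierCoeff a n φ).re * (Yoshida1992.fourierCoeff a n ψ).re / (2 * a)
        + (Yoshida1992.fourierCoeff a n φ).re * (Yoshida1992.fourierCoeff a n ψ).re / (2 * a))
      ((∫ x, φ x * conj (ψ x)).re
        + (Yoshida1992.fourierCoeff a 0 φ).re * (Yoshida1992.fourierCoeff a 0 ψ).re / (2 * a)) := by
  have hP := hasSum_fourierCoeff_mul_conj ha hzφ hcφ (by rw [heφ]) hsφ hcψ (by rw [heψ]) hsψ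
  -- the terms are real: `ĉ_n(φ) conj ĉ_n(ψ)/(2a) = ↑(Re ĉ_n(φ) Re ĉ_n(ψ)/(2a))`
  set t : ℤ → ℝ := fun n ↦
    (Yoshida1992.fourierCoeff a n φ).re * (Yoshida1992.fourierCoeff a n ψ).re / (2 * a) with ht
  have hterm : ∀ n : ℤ, Yoshida1992.fourierCoeff a n φ * conj (Yoshida1992.fourierCoeff a n ψ) / (2 * (a : ℂ))
      = ((t n : ℝ) : ℂ) := by
    intro n
    rw [fourierCoeff_eq_ofReal_re heφ hrφ a n, fourierCoeff_eq_ofReal_re heψ hrψ a n, Complex.conj_ofReal]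
    simp only [ht]
    push_cast
    ring
  simp_rw [hterm] at hP
  have hre : HasSum t (∫ x, φ x * conj (ψ x)).re := by
    have h := (Complex.hasSum_iff _ _).1 hP
    simpa only [Function.comp_def, Complex.ofReal_re] using h.1
  -- fold `ℤ` to `ℕ`: `t (−n) = t n`
  have hfold := hre.nat_add_neg
  have hsym : ∀ n : ℕ, t (-(n : ℤ)) = t n := by
    intro n
    simp only [ht, fourierCoeff_neg_eq_of_even heφ, fourierCoeff_neg_eq_of_even heψ]
  simp only [hsym] at hfold
  simpa only [ht, Int.cast_natCast, Int.cast_zero] using hfold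

/-! ## Series bookkeeping -/

/-- Pure bookkeeping: if `HasSum (n ↦ c_n d_n/α + c_n d_n/α) (s + c_0 d_0/α)` (`α > 0`) then the weighted tail series
`Σ'_n [B'+1 ≤ n] (w_n c_n/√α)(w_n d_n/√α)` (`w_0 = 1`, `w_n = 2`) equals
`2s − 2(c_0/√α)(d_0/√α) − Σ_{n∈Ico 1 (B'+1)} (2c_n/√α)(2d_n/√α)`. -/
theorem tsum_table_eq_of_hasSum {α : ℝ} (hα : 0 < α) (c d : ℕ → ℝ) (s : ℝ) (B' : ℕ)
    (h : HasSum (fun n ↦ c n * d n / α + c n * d n / α) (s + c 0 * d 0 / α)) :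
    (∑' n : ℕ, if B' + 1 ≤ n then
        ((if n = 0 then 1 else 2) * c n / Real.sqrt α) * ((if n = 0 then 1 else 2) * d n / Real.sqrt α) else 0)
      = 2 * s - 2 * ((c 0 / Real.sqrt α) * (d 0 / Real.sqrt α))
        - ∑ n ∈ Finset.Ico 1 (B' + 1), (2 * c n / Real.sqrt α) * (2 * d n / Real.sqrt α) := by
  have hsq : Real.sqrt α ^ 2 = α := Real.sq_sqrt hα.le
  have hsq0 : Real.sqrt α ≠ 0 := (Real.sqrt_pos.2 hα).ne'
  set u : ℕ → ℝ := fun n ↦ c n * d n / α + c n * d n / α with hu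
  set F : ℕ → ℝ := fun n ↦ if B' + 1 ≤ n then
      ((if n = 0 then 1 else 2) * c n / Real.sqrt α) * ((if n = 0 then 1 else 2) * d n / Real.sqrt α)
    else 0 with hF
  have hFshift : ∀ i : ℕ, F (i + (B' + 1)) = 2 * u (i + (B' + 1)) := by
    intro i
    have h1 : B' + 1 ≤ i + (B' + 1) := Nat.le_add_left _ _
    have h0 : i + (B' + 1) ≠ 0 := by omega
    simp only [hF, h1, if_true, h0, if_false, hu]
    field_simp
    rw [hsq]
    ring
  have hFzero : ∀ i ∈ Finset.range (B' + 1), F i = 0 := by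
    intro i hi
    have : ¬ (B' + 1 ≤ i) := by simpa [Finset.mem_range, not_le] using hi
    simp only [hF, this, if_false]
  have hu2 : Summable fun n ↦ 2 * u n := h.summable.mul_left 2
  have hFs : Summable F := by
    have h' : Summable fun i ↦ F (i + (B' + 1)) :=
      ((summable_nat_add_iff (B' + 1)).2 hu2).congr (fun i ↦ (hFshift i).symm)
    exact (summable_nat_add_iff (B' + 1)).1 h'
  have hsplit := (hFs.sum_add_tsum_nat_add (B' + 1)).symm
  rw [Finset.sum_eq_zero hFzero, zero_add] at hsplit
  have hshiftSum : HasSum (fun i ↦ 2 * u (i + (B' + 1)))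
      (2 * (s + c 0 * d 0 / α - ∑ i ∈ Finset.range (B' + 1), u i)) := by
    have h1 := (hasSum_nat_add_iff' (B' + 1)).2 h
    simpa only [mul_sub] using h1.mul_left 2
  have htail : ∑' i, F (i + (B' + 1)) = 2 * (s + c 0 * d 0 / α - ∑ i ∈ Finset.range (B' + 1), u i) := by
    rw [show (fun i ↦ F (i + (B' + 1))) = fun i ↦ 2 * u (i + (B' + 1)) from funext hFshift]
    exact hshiftSum.tsum_eq
  change ∑' n, F n = _
  rw [hsplit, htail, Finset.range_eq_Ico, Finset.sum_eq_sum_Ico_succ_bot (Nat.succ_pos B')]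
  have hsum : ∑ n ∈ Finset.Ico 1 (B' + 1), (2 * c n / Real.sqrt α) * (2 * d n / Real.sqrt α)
      = ∑ n ∈ Finset.Ico 1 (B' + 1), 2 * u n := by
    refine Finset.sum_congr rfl fun n _ ↦ ?_
    simp only [hu]
    field_simp
    rw [hsq]
    ring
  have h0 : (c 0 / Real.sqrt α) * (d 0 / Real.sqrt α) = c 0 * d 0 / α := by
    field_simp
    rw [hsq]
    ring
  rw [hsum, h0, ← Finset.mul_sum]
  simp only [zero_add, Nat.succ_eq_add_one]
  have hu0 : u 0 = c 0 * d 0 / α + c 0 * d 0 / α := rfl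
  rw [hu0]
  ring

/-! ## The door's `E∞` in closed form -/

/-- **`E∞` of the C∞ front door in closed form (even sector).**  For `C³` even real profiles `f, g` with
`f′(−a) = f′(a)`, `g′(−a) = g′(a)` (`a > 0`) and every `B'`:
`Σ'_{n} [B'+1 ≤ n] V_f(n)V_g(n) = 2 Re ∫ 1f conj(1g) − 2 V_f(0)V_g(0) − Σ_{n∈Ico 1 (B'+1)} V_f(n)V_g(n)`,
`V_f(n) = d_n² Re ĉ_n(1f)/√(2a)`, `d_0² = 1`, `d_n² = 2` — the series hypothesised in `weilPositivityOn_of_formatC_cinf`. -/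
theorem tsum_evenTable_mul_eq (ha : 0 < a) {f g : ℝ → ℂ} (hf : ContDiff ℝ 3 f) (hfe : ∀ x, f (-x) = f x)
    (hfr : ∀ x, conj (f x) = f x) (hf1 : deriv f (-a) = deriv f a) (hg : ContDiff ℝ 3 g)
    (hge : ∀ x, g (-x) = g x) (hgr : ∀ x, conj (g x) = g x) (hg1 : deriv g (-a) = deriv g a) (B' : ℕ) :
    (∑' n : ℕ, if B' + 1 ≤ n then
        ((if n = 0 then 1 else 2) * (Yoshida1992.fourierCoeff a n ((Icc (-a) a).indicator f)).re /
          Real.sqrt (2 * a)) *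
        ((if n = 0 then 1 else 2) * (Yoshida1992.fourierCoeff a n ((Icc (-a) a).indicator g)).re /
          Real.sqrt (2 * a)) else 0)
      = 2 * (∫ x, (Icc (-a) a).indicator f x * conj ((Icc (-a) a).indicator g x)).re
        - 2 * (((Yoshida1992.fourierCoeff a 0 ((Icc (-a) a).indicator f)).re / Real.sqrt (2 * a)) *
            ((Yoshida1992.fourierCoeff a 0 ((Icc (-a) a).indicator g)).re / Real.sqrt (2 * a)))
        - ∑ n ∈ Finset.Ico 1 (B' + 1),
            (2 * (Yoshida1992.fourierCoeff a n ((Icc (-a) a).indicator f)).re / Real.sqrt (2 * a)) *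
            (2 * (Yoshida1992.fourierCoeff a n ((Icc (-a) a).indicator g)).re / Real.sqrt (2 * a)) := by
  have hφe : ∀ x, (Icc (-a) a).indicator f (-x) = (Icc (-a) a).indicator f x := indicator_even hfe a
  have hφr : ∀ x, conj ((Icc (-a) a).indicator f x) = (Icc (-a) a).indicator f x := indicator_real hfr a
  have hψe : ∀ x, (Icc (-a) a).indicator g (-x) = (Icc (-a) a).indicator g x := indicator_even hge a
  have hψr : ∀ x, conj ((Icc (-a) a).indicator g x) = (Icc (-a) a).indicator g x := indicator_real hgr a
  obtain ⟨-, hcφ, -, hsφ, -⟩ := summableClass_indicator_of_contDiff ha hf (hfe a) hf1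
  obtain ⟨-, hcψ, -, hsψ, -⟩ := summableClass_indicator_of_contDiff ha hg (hge a) hg1
  have hzφ : ∀ x, x ∉ Icc (-a) a → (Icc (-a) a).indicator f x = 0 := fun x hx ↦ indicator_of_notMem hx _
  have hH := hasSum_re_fourierCoeff_mul_of_even_real ha hzφ hcφ hφe hφr hsφ hcψ hψe hψr hsψ
  have h2a : (0 : ℝ) < 2 * a := by positivity
  have key := tsum_table_eq_of_hasSum h2a
    (fun n ↦ (Yoshida1992.fourierCoeff a n ((Icc (-a) a).indicator f)).re)
    (fun n ↦ (Yoshida1992.fourierCoeff a n ((Icc (-a) a).indicator g)).re)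
    ((∫ x, (Icc (-a) a).indicator f x * conj ((Icc (-a) a).indicator g x)).re) B'
    (by simpa only [Nat.cast_zero] using hH)
  simpa only [Nat.cast_zero] using key

/-! ## Odd sector -/

/-- For odd real windows `φ, ψ` of the summable class (`a > 0`): with `t_n = Im ĉ_n(φ)·Im ĉ_n(ψ)/(2a)`,
`HasSum (n : ℕ ↦ t_n + t_n) (Re ∫ φ conj ψ)` — Parseval over `ℤ` folded by `ĉ_{−n} = −ĉ_n ∈ iℝ` (`ĉ_0 = 0`). -/
theorem hasSum_im_fourierCoeff_mul_of_odd_real (ha : 0 < a) {φ ψ : ℝ → ℂ}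
    (hzφ : ∀ x, x ∉ Icc (-a) a → φ x = 0) (hcφ : ContinuousOn φ (Icc (-a) a)) (hoφ : ∀ x, φ (-x) = -φ x)
    (hrφ : ∀ x, conj (φ x) = φ x) (heφ : φ (-a) = φ a) (hsφ : Summable fun n : ℤ ↦ ‖Yoshida1992.fourierCoeff a n φ‖)
    (hcψ : ContinuousOn ψ (Icc (-a) a)) (hoψ : ∀ x, ψ (-x) = -ψ x) (hrψ : ∀ x, conj (ψ x) = ψ x)
    (heψ : ψ (-a) = ψ a) (hsψ : Summable fun n : ℤ ↦ ‖Yoshida1992.fourierCoeff a n ψ‖) :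
    HasSum (fun n : ℕ ↦ (Yoshida1992.fourierCoeff a n φ).im * (Yoshida1992.fourierCoeff a n ψ).im / (2 * a)
        + (Yoshida1992.fourierCoeff a n φ).im * (Yoshida1992.fourierCoeff a n ψ).im / (2 * a))
      ((∫ x, φ x * conj (ψ x)).re) := by
  have hP := hasSum_fourierCoeff_mul_conj ha hzφ hcφ heφ hsφ hcψ heψ hsψ
  set t : ℤ → ℝ := fun n ↦
    (Yoshida1992.fourierCoeff a n φ).im * (Yoshida1992.fourierCoeff a n ψ).im / (2 * a) with ht
  have hterm : ∀ n : ℤ, Yoshida1992.fourierCoeff a n φ * conj (Yoshida1992.fourierCoeff a n ψ) / (2 * (a : ℂ))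
      = ((t n : ℝ) : ℂ) := by
    intro n
    rw [fourierCoeff_eq_im_mul_I hoφ hrφ a n, fourierCoeff_eq_im_mul_I hoψ hrψ a n, map_mul, Complex.conj_ofReal,
      Complex.conj_I]
    simp only [ht]
    push_cast
    have hI : I * I = -1 := Complex.I_mul_I
    linear_combination ((Yoshida1992.fourierCoeff a n φ).im * (Yoshida1992.fourierCoeff a n ψ).im / (2 * a) : ℂ) * (-hI)
  simp_rw [hterm] at hP
  have hre : HasSum t (∫ x, φ x * conj (ψ x)).re := by
    have h := (Complex.hasSum_iff _ _).1 hP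
    simpa only [Function.comp_def, Complex.ofReal_re] using h.1
  have hfold := hre.nat_add_neg
  have hsym : ∀ n : ℕ, t (-(n : ℤ)) = t n := by
    intro n
    simp only [ht, fourierCoeff_neg_eq_neg_of_odd hoφ, fourierCoeff_neg_eq_neg_of_odd hoψ, Complex.neg_im,
      neg_mul_neg]  -- (-y)(-y') = y y'
  have h0 : t 0 = 0 := by
    have h := fourierCoeff_neg_eq_neg_of_odd hoφ a 0
    rw [neg_zero] at h
    have hz : Yoshida1992.fourierCoeff a 0 φ = 0 := by
      have : (2 : ℂ) * Yoshida1992.fourierCoeff a 0 φ = 0 := by linear_combination h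
      simpa using this
    simp only [ht]
    simp [hz]
  simp only [hsym, h0, add_zero] at hfold
  simpa only [ht, Int.cast_natCast] using hfold

/-- Pure bookkeeping (odd tables): if `HasSum (n ↦ y_n y'_n/α + y_n y'_n/α) s` (`α > 0`) then
`Σ'_k [B ≤ k] (2y_{k+1}/√α)(2y'_{k+1}/√α) = 2s − Σ_{k<B} (2y_{k+1}/√α)(2y'_{k+1}/√α) − 2·(y_0y'_0/α + y_0y'_0/α)`. -/
theorem tsum_shiftTable_eq_of_hasSum {α : ℝ} (hα : 0 < α) (y y' : ℕ → ℝ) (s : ℝ) (B : ℕ)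
    (h : HasSum (fun n ↦ y n * y' n / α + y n * y' n / α) s) :
    (∑' k : ℕ, if B ≤ k then (2 * y (k + 1) / Real.sqrt α) * (2 * y' (k + 1) / Real.sqrt α) else 0)
      = 2 * s - ∑ k ∈ Finset.range B, (2 * y (k + 1) / Real.sqrt α) * (2 * y' (k + 1) / Real.sqrt α)
        - 2 * (y 0 * y' 0 / α + y 0 * y' 0 / α) := by
  have hsq : Real.sqrt α ^ 2 = α := Real.sq_sqrt hα.le
  have hsq0 : Real.sqrt α ≠ 0 := (Real.sqrt_pos.2 hα).ne'
  set u : ℕ → ℝ := fun n ↦ y n * y' n / α + y n * y' n / α with hu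
  set G : ℕ → ℝ := fun k ↦ (2 * y (k + 1) / Real.sqrt α) * (2 * y' (k + 1) / Real.sqrt α) with hG
  have hGu : ∀ k, G k = 2 * u (k + 1) := by
    intro k
    simp only [hG, hu]
    field_simp
    rw [hsq]
    ring
  set F : ℕ → ℝ := fun k ↦ if B ≤ k then G k else 0 with hF
  have hFshift : ∀ i : ℕ, F (i + B) = 2 * u (i + B + 1) := by
    intro i
    have h1 : B ≤ i + B := Nat.le_add_left _ _
    simp only [hF, h1, if_true, hGu]
  have hFzero : ∀ i ∈ Finset.range B, F i = 0 := by
    intro i hi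
    have : ¬ (B ≤ i) := by simpa [Finset.mem_range, not_le] using hi
    simp only [hF, this, if_false]
  -- `HasSum (k ↦ u (k+1)) (s − u 0)` and then shifted by `B`
  have h1 : HasSum (fun k ↦ u (k + 1)) (s - ∑ i ∈ Finset.range 1, u i) := (hasSum_nat_add_iff' 1).2 h
  rw [Finset.sum_range_one] at h1
  have h2 : HasSum (fun i ↦ u (i + B + 1)) (s - u 0 - ∑ i ∈ Finset.range B, u (i + 1)) := by
    have := (hasSum_nat_add_iff' B).2 h1
    simpa only [add_right_comm] using this
  have h3 : HasSum (fun i ↦ F (i + B)) (2 * (s - u 0 - ∑ i ∈ Finset.range B, u (i + 1))) := by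
    have := h2.mul_left 2
    exact this.congr_fun fun i ↦ hFshift i
  have hFs : Summable F := (summable_nat_add_iff B).1 h3.summable
  have hsplit := (hFs.sum_add_tsum_nat_add B).symm
  rw [Finset.sum_eq_zero hFzero, zero_add] at hsplit
  change ∑' k, F k = _
  rw [hsplit, h3.tsum_eq]
  have hsumG : ∑ k ∈ Finset.range B, (2 * y (k + 1) / Real.sqrt α) * (2 * y' (k + 1) / Real.sqrt α)
      = ∑ k ∈ Finset.range B, 2 * u (k + 1) := Finset.sum_congr rfl fun k _ ↦ hGu k
  rw [hsumG, ← Finset.mul_sum]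
  have hu0 : u 0 = y 0 * y' 0 / α + y 0 * y' 0 / α := rfl
  rw [hu0]
  ring

/-- **`E∞` of the C∞ front door in closed form (odd sector).**  For `C³` odd real profiles `f, g` with
`f(a) = g(a) = 0`, `f′(−a) = f′(a)`, `g′(−a) = g′(a)` (`a > 0`) and every `B`:
`Σ'_{k} [B ≤ k] V_f(k)V_g(k) = 2 Re ∫ 1f conj(1g) − Σ_{k<B} V_f(k)V_g(k)`, `V_f(k) = 2 Im ĉ_{k+1}(1f)/√(2a)` — the series
hypothesised in the odd half of `weilPositivityOn_of_formatC_cinf`. -/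
theorem tsum_oddTable_mul_eq (ha : 0 < a) {f g : ℝ → ℂ} (hf : ContDiff ℝ 3 f) (hfo : ∀ x, f (-x) = -f x)
    (hfr : ∀ x, conj (f x) = f x) (hfa : f a = 0) (hf1 : deriv f (-a) = deriv f a) (hg : ContDiff ℝ 3 g)
    (hgo : ∀ x, g (-x) = -g x) (hgr : ∀ x, conj (g x) = g x) (hga : g a = 0) (hg1 : deriv g (-a) = deriv g a)
    (B : ℕ) :
    (∑' k : ℕ, if B ≤ k then
        (2 * (Yoshida1992.fourierCoeff a ((k : ℤ) + 1) ((Icc (-a) a).indicator f)).im / Real.sqrt (2 * a)) *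
        (2 * (Yoshida1992.fourierCoeff a ((k : ℤ) + 1) ((Icc (-a) a).indicator g)).im / Real.sqrt (2 * a)) else 0)
      = 2 * (∫ x, (Icc (-a) a).indicator f x * conj ((Icc (-a) a).indicator g x)).re
        - ∑ k ∈ Finset.range B,
            (2 * (Yoshida1992.fourierCoeff a ((k : ℤ) + 1) ((Icc (-a) a).indicator f)).im / Real.sqrt (2 * a)) *
            (2 * (Yoshida1992.fourierCoeff a ((k : ℤ) + 1) ((Icc (-a) a).indicator g)).im / Real.sqrt (2 * a)) := by
  have hφo : ∀ x, (Icc (-a) a).indicator f (-x) = -(Icc (-a) a).indicator f x := indicator_odd hfo a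
  have hφr : ∀ x, conj ((Icc (-a) a).indicator f x) = (Icc (-a) a).indicator f x := indicator_real hfr a
  have hψo : ∀ x, (Icc (-a) a).indicator g (-x) = -(Icc (-a) a).indicator g x := indicator_odd hgo a
  have hψr : ∀ x, conj ((Icc (-a) a).indicator g x) = (Icc (-a) a).indicator g x := indicator_real hgr a
  have hfe₀ : f (-a) = f a := by rw [hfo, hfa, neg_zero]
  have hge₀ : g (-a) = g a := by rw [hgo, hga, neg_zero]
  obtain ⟨-, hcφ, heφ, hsφ, -⟩ := summableClass_indicator_of_contDiff ha hf hfe₀ hf1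
  obtain ⟨-, hcψ, heψ, hsψ, -⟩ := summableClass_indicator_of_contDiff ha hg hge₀ hg1
  have hzφ : ∀ x, x ∉ Icc (-a) a → (Icc (-a) a).indicator f x = 0 := fun x hx ↦ indicator_of_notMem hx _
  have hH := hasSum_im_fourierCoeff_mul_of_odd_real ha hzφ hcφ hφo hφr heφ hsφ hcψ hψo hψr heψ hsψ
  have h2a : (0 : ℝ) < 2 * a := by positivity
  -- `Im ĉ_0 = 0` for the odd window, so the `y_0` correction vanishes
  have hc0 : (Yoshida1992.fourierCoeff a ((0 : ℕ) : ℤ) ((Icc (-a) a).indicator f)).im = 0 := by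
    have h := fourierCoeff_neg_eq_neg_of_odd hφo a 0
    rw [neg_zero] at h
    have hz : Yoshida1992.fourierCoeff a 0 ((Icc (-a) a).indicator f) = 0 := by
      have : (2 : ℂ) * Yoshida1992.fourierCoeff a 0 ((Icc (-a) a).indicator f) = 0 := by linear_combination h
      simpa using this
    rw [Nat.cast_zero, hz, Complex.zero_im]
  have key := tsum_shiftTable_eq_of_hasSum h2a
    (fun n ↦ (Yoshida1992.fourierCoeff a n ((Icc (-a) a).indicator f)).im)
    (fun n ↦ (Yoshida1992.fourierCoeff a n ((Icc (-a) a).indicator g)).im)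
    ((∫ x, (Icc (-a) a).indicator f x * conj ((Icc (-a) a).indicator g x)).re) B hH
  simp only [hc0, zero_mul, zero_div, add_zero, mul_zero, sub_zero, Nat.cast_add, Nat.cast_one] at key
  simpa only [Nat.cast_add, Nat.cast_one] using key

end Summit.RiemannHypothesis.RiemannHypothesis.Theorems.WeilFormatC

end
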